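import Summits.ResolutionOfSingularities.ResolutionOfSingularities.Theorems.FrobeniusLadderFInjectiveMacaulayficationFullLocalOrderCap
import HarnessLib

/-!
# K9, LOCAL-RING FORM — THE SQUARE BUDGET AT ANY POINT OF ANY REGULAR LOCAL RING: `f = h²·l + g`, `h ∈ 𝔪^a` (`a ≥ 1`), `l ∈ 𝔪^b`, `g ∈ 𝔪^c`, `2a + b ≤ c`, and
# `2a + b + c ≥ 2·dim R + 1` ⇒ `f^{p−1} ∈ 𝔪^{[p]}` (every `p ≥ 3`) — so a FULL hypersurface point satisfies `ord(h²l) + ord(g) ≤ 2·dim R`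
# (crux `FInjectiveMacaulayfication` stmt-ResolutionOfSingularities-15315, chain w45a; the coordinate-free twin of res-L1-w45a-lead-1 g15ʼs K9 ✓p723669 `FullSquareBudget.square_budget`
# (polynomial ring, arbitrary weights: `w(h²l) + w(g) ≤ 2Σwᵢ`) in the way ✓p721620 `FullLocalOrderCap` is the twin of #9/#9♯; `Lines/T-register.md` rev 10 7a938859fd4269f0 row #11♯,
# `T-disc.md` §0.2 / §0.22 (drop-point and section square budgets); seat res-L1-w45a-stub-1 g17, idle-serve initiative)

[OURS · L1 W4.5a] Support file (`--supports stmt-ResolutionOfSingularities-15315 --as helper`); theorems only; GENERIC (any regular local ring; any residue field; closed point or not); no named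
fact; NOT a statement of any manuscript; nothing of the crux is proved (Fedder-test bookkeeping behind the T-side budgets). AI-written (AI review is weaker than expert review).

THE ARGUMENT (ideal level, characteristic-free, any `p ≥ 3`, `R` regular local of dimension `d`). Expand `(h²l + g)^{p−1} = Σₖ C(p−1,k)·(h²l)^k·g^{p−1−k}`. Terms with `2k ≥ p` contain `h^{2k} = h^p·h^{2k−p}`
and `h^p ∈ 𝔪^{[p]}` (`h ∈ 𝔪`; `𝔪^{[p]}` is by definition generated by `p`-th powers). Terms with `2k ≤ p − 1` lie in `𝔪^{k(2a+b) + (p−1−k)c}` and, because `2a + b ≤ c`, the exponent is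
`≥ (p−1)(2a+b+c)/2 ≥ (p−1)(2d+1)/2 ≥ d(p−1) + 1`, so they lie in `𝔪^{d(p−1)+1} ⊆ 𝔪^{[p]}` (✓ `FullLocalOrderCap.maximalIdeal_pow_le_frobeniusPower`, the pigeonhole on `d` generators). Hence
★★ `pow_mem_frobeniusPower_of_sq_mul_add`. With `g = 0` (and no budget hypothesis): `(h²l)^{p−1} ∈ 𝔪^{[p]}` as soon as `h ∈ 𝔪` — ★ `sq_mul_pow_mem_frobeniusPower`, the local twin of
✓ `FullSquareBudget.sq_mul_pow_mem_frobPow` and of TC-β ✓p717528. By Fedder (✓ `FullLocalOrderCap.not_clause_of_pow_mem_frobeniusPower`, characteristic `p`): ★★★ `sq_budget_of_clause` / `sq_budget_of_fullCl`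
— **on a FULL hypersurface point of a regular germ of dimension `d` (char `p ≥ 3`), an equation `h²l + g` with `h ∈ 𝔪^a`, `l ∈ 𝔪^b`, `g ∈ 𝔪^c`, `2a + b ≤ c` has `2a + b + c ≤ 2d`:
F-purity bounds the `𝔪`-adic distance of the equation from the square-cubics**, at every point, with no coordinates or weights (the weighted polynomial form is lead-1ʼs K9).
* §1 `budget_arith` (the exponent inequality), `sq_mul_pow_mem_pow` (`(h²l)^k ∈ 𝔪^{k(2a+b)}`), ★ `sq_mul_pow_mem_frobeniusPower`, ★★ `pow_mem_frobeniusPower_of_sq_mul_add`;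
  §2 (char `p`, universe 0) ★★★ `sq_budget_of_clause`, `sq_budget_of_fullCl`, ★ `not_fullCl_of_sq_mul`.
[cite: Fedder1983, Prop. 1.7 and Thm. 1.12 (criterion, through ✓p721620)] [folklore computation]
-/

-- single-problem summit: the doubled namespace component is forced
set_option linter.dupNamespace false

open IsLocalRing Literature.RingTheory.TightClosure

namespace Summit.ResolutionOfSingularities.ResolutionOfSingularities.Theorems.FInjectiveMacaulayfication.FullLocalSquareBudget

open Summit.ResolutionOfSingularities.ResolutionOfSingularities.Theorems.FInjectiveMacaulayfication FullLocalOrderCap SliceableCentre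

section Generic

variable {R : Type*} [CommRing R]

/-- The exponent inequality: `2k ≤ p − 1`, `2a + b ≤ c`, `2d + 1 ≤ 2a + b + c`, `3 ≤ p` ⇒ `d(p−1) + 1 ≤ k(2a+b) + (p−1−k)c`. [plumbing] -/
theorem budget_arith {p d a b c k : ℕ} (hp : 3 ≤ p) (hk : 2 * k ≤ p - 1) (hle : 2 * a + b ≤ c) (hbud : 2 * d + 1 ≤ 2 * a + b + c) :
    d * (p - 1) + 1 ≤ k * (2 * a + b) + (p - 1 - k) * c := by
  obtain ⟨m, hm⟩ : ∃ m, p - 1 = k + m := ⟨p - 1 - k, by omega⟩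
  have hkm : k ≤ m := by omega
  rw [hm, show k + m - k = m from by omega]
  set S := 2 * a + b with hS
  -- `2(kS + mc) = (k+m)(S+c) + (m−k)(c−S) ≥ (k+m)(2d+1) ≥ 2d(k+m) + 2`
  have h1 : (k + m) * (2 * d + 1) ≤ (k + m) * (S + c) := Nat.mul_le_mul_left _ hbud
  have h2 : k * c + m * S ≤ k * S + m * c := by nlinarith [Nat.mul_le_mul hkm hle]
  have h3 : 2 ≤ k + m := by omega
  nlinarith [h1, h2, h3]

/-- `(h²·l)^k ∈ 𝔪^{k(2a+b)}` for `h ∈ 𝔪^a`, `l ∈ 𝔪^b` (any ideal `I` in place of `𝔪`). [plumbing] -/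
theorem sq_mul_pow_mem_pow (I : Ideal R) {h l : R} {a b : ℕ} (hh : h ∈ I ^ a) (hl : l ∈ I ^ b) (k : ℕ) :
    (h ^ 2 * l) ^ k ∈ I ^ (k * (2 * a + b)) := by
  have h1 : h ^ 2 * l ∈ I ^ (2 * a + b) := by
    rw [pow_add, pow_mul']
    exact Ideal.mul_mem_mul (Ideal.pow_mem_pow hh 2) hl
  rw [mul_comm k, pow_mul]
  exact Ideal.pow_mem_pow h1 k

/-- ★ **EXACT SQUARE-CUBICS ARE NEVER FEDDER SURVIVORS** (local form, any `p ≥ 2`, any ideal `I`): `h ∈ I` ⇒ `(h²·l)^{p−1} ∈ I^{[p]}` (`2(p−1) ≥ p`, so `h^p` divides). The local twin of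
✓ `FullSquareBudget.sq_mul_pow_mem_frobPow` (res-L1-w45a-lead-1) and of TC-β ✓p717528. [folklore computation] -/
theorem sq_mul_pow_mem_frobeniusPower (I : Ideal R) {p : ℕ} (hp : 2 ≤ p) {h : R} (hh : h ∈ I) (l : R) :
    (h ^ 2 * l) ^ (p - 1) ∈ frobeniusPower p I := by
  have hdecomp : (h ^ 2 * l) ^ (p - 1) = h ^ p * (h ^ (p - 2) * l ^ (p - 1)) := by
    rw [mul_pow, ← pow_mul, ← mul_assoc, ← pow_add]
    congr 2
    omega
  rw [hdecomp]
  exact Ideal.mul_mem_right _ _ (pow_mem_frobeniusPower hh)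

/-- ★★ **THE SQUARE BUDGET, local form** (ideal level, characteristic-free, every `p ≥ 3`): in a regular local ring of dimension `d`, if `h ∈ 𝔪^a` with `a ≥ 1`, `l ∈ 𝔪^b`, `g ∈ 𝔪^c`,
`2a + b ≤ c` and `2d + 1 ≤ 2a + b + c`, then `(h²l + g)^{p−1} ∈ 𝔪^{[p]}`. [OURS · local twin of K9; folklore computation] -/
theorem pow_mem_frobeniusPower_of_sq_mul_add [IsRegularLocalRing R] {p : ℕ} (hp : 3 ≤ p) {d : ℕ} (hd : ringKrullDim R = d) {h l g : R} {a b c : ℕ}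
    (ha : 1 ≤ a) (hh : h ∈ maximalIdeal R ^ a) (hl : l ∈ maximalIdeal R ^ b) (hg : g ∈ maximalIdeal R ^ c) (hle : 2 * a + b ≤ c) (hbud : 2 * d + 1 ≤ 2 * a + b + c)
    (f : R) (hf : f = h ^ 2 * l + g) :
    f ^ (p - 1) ∈ frobeniusPower p (maximalIdeal R) := by
  rw [hf, add_pow]
  refine Ideal.sum_mem _ fun k hk => ?_
  rw [Finset.mem_range] at hk
  refine Ideal.mul_mem_right _ _ ?_
  rcases le_or_gt p (2 * k) with hpk | hpk
  · -- `2k ≥ p`: `h^p` divides `(h²l)^k`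
    have hm : h ∈ maximalIdeal R := Ideal.pow_le_self (by omega) hh
    have hdecomp : (h ^ 2 * l) ^ k = h ^ p * (h ^ (2 * k - p) * l ^ k) := by
      rw [mul_pow, ← pow_mul, ← mul_assoc, ← pow_add]
      congr 2
      omega
    rw [hdecomp, mul_assoc]
    exact Ideal.mul_mem_right _ _ (pow_mem_frobeniusPower hm)
  · -- `2k ≤ p − 1`: high order
    have hA := sq_mul_pow_mem_pow (maximalIdeal R) hh hl k
    have hB : g ^ (p - 1 - k) ∈ maximalIdeal R ^ ((p - 1 - k) * c) := by
      rw [mul_comm, pow_mul]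
      exact Ideal.pow_mem_pow hg _
    have hAB : (h ^ 2 * l) ^ k * g ^ (p - 1 - k) ∈ maximalIdeal R ^ (k * (2 * a + b) + (p - 1 - k) * c) := by
      rw [pow_add]
      exact Ideal.mul_mem_mul hA hB
    exact maximalIdeal_pow_le_frobeniusPower p hd (budget_arith hp (by omega) hle hbud) hAB

end Generic

/-! ## §2 Fedder readings (characteristic `p`, universe `0` as the clause abbreviations) -/

section Fedder

variable {R : Type} [CommRing R] (p : ℕ) [Fact p.Prime]

/-- ★★★ **THE SQUARE BUDGET AT A FULL HYPERSURFACE POINT**: `R` regular local of characteristic `p ≥ 3` and dimension `d`; if the hypersurface ring `R/(f)` (`f ≠ 0`) satisfies the cruxʼs stalk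
clause `CMCl ∧ FCl p` and `f = h²l + g` with `h ∈ 𝔪^a` (`a ≥ 1`), `l ∈ 𝔪^b`, `g ∈ 𝔪^c`, `2a + b ≤ c`, then `2a + b + c ≤ 2d`. Coordinate-free K9 at every point of every regular germ.
[OURS · local twin of K9; cite: Fedder1983, Prop. 1.7 and Thm. 1.12] -/
theorem sq_budget_of_clause [IsRegularLocalRing R] [CharP R p] (hp : 3 ≤ p) {d : ℕ} (hd : ringKrullDim R = d) {h l g : R} {a b c : ℕ}
    (ha : 1 ≤ a) (hh : h ∈ maximalIdeal R ^ a) (hl : l ∈ maximalIdeal R ^ b) (hg : g ∈ maximalIdeal R ^ c) (hle : 2 * a + b ≤ c)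
    (f : R) (hf : f = h ^ 2 * l + g) (hf0 : f ≠ 0)
    (hfull : CMCl (R ⧸ Ideal.span {f}) ∧ FCl p (R ⧸ Ideal.span {f})) :
    2 * a + b + c ≤ 2 * d := by
  by_contra hlt
  have hbud : 2 * d + 1 ≤ 2 * a + b + c := by omega
  have hfm : f ∈ maximalIdeal R := by
    rw [hf]
    have hm : h ∈ maximalIdeal R := Ideal.pow_le_self (by omega) hh
    have hgm : g ∈ maximalIdeal R := Ideal.pow_le_self (by omega) hg
    exact Ideal.add_mem _ (Ideal.mul_mem_right _ _ (by rw [pow_two]; exact Ideal.mul_mem_right _ _ hm)) hgm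
  exact not_clause_of_pow_mem_frobeniusPower p hfm hf0 (pow_mem_frobeniusPower_of_sq_mul_add hp hd ha hh hl hg hle hbud f hf) hfull

/-- The same in the `FullCl` letter. [OURS · local twin of K9; cite: Fedder1983, Prop. 1.7 and Thm. 1.12] -/
theorem sq_budget_of_fullCl [IsRegularLocalRing R] [CharP R p] (hp : 3 ≤ p) {d : ℕ} (hd : ringKrullDim R = d) {h l g : R} {a b c : ℕ}
    (ha : 1 ≤ a) (hh : h ∈ maximalIdeal R ^ a) (hl : l ∈ maximalIdeal R ^ b) (hg : g ∈ maximalIdeal R ^ c) (hle : 2 * a + b ≤ c)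
    (f : R) (hf : f = h ^ 2 * l + g) (hf0 : f ≠ 0) (hfull : FullCl p (R ⧸ Ideal.span {f})) :
    2 * a + b + c ≤ 2 * d :=
  sq_budget_of_clause p hp hd ha hh hl hg hle f hf hf0 ((SeparableBaseChangeAscent.cmCl_and_fCl_iff p _).mpr hfull.2)

/-- ★ An exact square-cubic `h²·l` (`h ∈ 𝔪`, `h²l ≠ 0`) never defines a FULL hypersurface ring (any prime `p`). [OURS; cite: Fedder1983, Prop. 1.7 and Thm. 1.12] -/
theorem not_fullCl_of_sq_mul [IsRegularLocalRing R] [CharP R p] {h : R} (hh : h ∈ maximalIdeal R) (l : R) (hf0 : h ^ 2 * l ≠ 0) :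
    ¬ FullCl p (R ⧸ Ideal.span {h ^ 2 * l}) :=
  not_fullCl_of_pow_mem_frobeniusPower p (by rw [pow_two, mul_assoc]; exact Ideal.mul_mem_right _ _ hh) hf0
    (sq_mul_pow_mem_frobeniusPower (maximalIdeal R) (Fact.out : p.Prime).two_le hh l)

end Fedder

end Summit.ResolutionOfSingularities.ResolutionOfSingularities.Theorems.FInjectiveMacaulayfication.FullLocalSquareBudget
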